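import Summits.CriticalPhenomena.CardyFormulaZ2.Theses.DyadicBetaRigidity
import Summits.CriticalPhenomena.CardyFormulaZ2.Theorems.CardyBoundaryCoulombGasHalfPlaneMarkDensityLawRigidityCorollaries
import Summits.CriticalPhenomena.CardyFormulaZ2.Theorems.CardyUniqueLimitCardyRigidityDefs
import Literature.Probability.RandomPlanarGeometry.SLECardyLimit
import Literature.Probability.RandomPlanarGeometry.LocalMartingaleProofs
import Literature.Probability.Process.BrownianRunningSupTransfer
import HarnessLib

/-!
# Disproof of `CardyRigidity` (crux stmt-CriticalPhenomena-0746, route DyadicBetaRigidity) — findings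

Crux (the same `Prop` in nine CardyFormulaZ2 route files):

    CardyRigidity := ∀ f : ℝ → ℝ, (∀ R : ConformalRectangle, R.HasCrossingLimit (bondDomainCrossingProb R) f)
                       → EqOn f cardyFunction (Ioo 0 1)

FINDINGS (cdisprove cycle 1, refuter-cdisprove-stmt-CriticalPhenomena-0746-0, 2026-08-17):

* §1 IRREFUTABILITY (kernel-checked, re-deriving the gen-1 attack): `crux_iff_ucl_imp_summit :
  CardyRigidity ↔ (CardyUniqueLimitThesis → CardyFormulaZ2)` and
  `not_crux_iff : ¬ CardyRigidity ↔ CardyUniqueLimitThesis ∧ ¬ CardyFormulaZ2`.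
  Every disproof of the crux is a proof of X_U (stmt-0745, open) AND a disproof of Cardy's formula on
  `ℤ²` (the conjunct).  No counterexample search, small model, degenerate regime or barrier reduction
  applies; the disprover's work on the crux proper is structural (§2–§3) and the attack goes to the
  PICKED line `crossing_martingale` (§4).
* §2 LOAD-BEARING ANALYSIS.  The crux has ONE hypothesis `H f := AllRectangleKernel f`.
  Dropped: `CardyRigidityWithoutH` (every `f` is `F` on `(0,1)`) is false (`crux_false_without_H`,
  `f = F + 1`).  Weakened to a sub-family `𝓡` of conformal rectangles (`CardyRigidityOn 𝓡`,
  `= CardyRigidity` at `𝓡 = univ`, antitone in `𝓡`): false at `𝓡 = ∅` (`cardyRigidityOn_empty_false`)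
  and — the reason it resists — ANY refutation of ANY sub-family version exhibits an all-`𝓡` crossing
  kernel (`exists_kernel_of_not_cardyRigidityOn`): for `𝓡 ≠ ∅` that is an existence-of-scaling-limit
  theorem for bond-`ℤ²` crossing probabilities, open in every instance (negatives index: stmt-0748
  `NegDegenerateArcs` refuted for all `R` — RSW keeps cluster points inside `(0,1)` — so not even a
  degenerate rectangle has a known limit).  No unconditional `_false_without_` finer than `∅` exists.
* §3 WHAT THE ROUTE CONSUMES.  `closes` of DyadicBetaRigidity uses the crux only inside the beta family:
  `BetaPinning := ∀ a ∈ (0,1), AllRectangleKernel (I_a) → a = 2/3` suffices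
  (`closes_of_betaPinning`, kernel-checked; `betaPinning_of_crux`).  Sharpening OPTION for the planner,
  not a defect; it is exactly the line's `stub_crossingMartingale (f := I_a)` + `stub_betaPinning`.
* §4 LINE `crossing_martingale` (4 stubs; definitions module landed as
  `Theorems/CardyUniqueLimitCardyRigidityDefs.lean`, imported here — every statement below is about
  the registered signatures).  LANDED as `Theorems/CardyRigidity/Negative/CrossingMartingaleTight.lean`
  (p145347 @ d302ca5584d5) and `Theorems/CardyRigidity/Negative/CrossingMartingaleBetaLaw.lean`
  (p145401 @ 215acd80236e) — import those under `Theorems/`; the main statements are reproduced here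
  (namespace `…Cruxes.CardyRigidity.Disproof`) so that this work file stands alone:
  (a) `isRegularDriver_sleDriving` — `√κ B` on the canonical space IS a regular driver (the `L³`
      running-sup clause = tree `memLp_runSup_of_le_four`): `IsRegularDriver` has a non-junk model;
  (b) `crossingObs_sleDriving_six_eq` — for `W = √6 B` the line's `I_{2/3}`-observable IS the tree's
      `cardyObsStopped 6` (`levelTime = cardyLevelTime` by `rfl`; `I_{2/3} = F` on `[0,1]`), hence
      `isCrossingMartingaleFamily_betaLaw_two_thirds_six` (`martingale_cardyObsStopped_six`);
  (c) TIGHTNESS of STUB B: `stub_betaPinning_tight`, `stub_betaPinning_conclusion_forced` (any true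
      statement of stub B's shape with conclusion `a = c` has `c = 2/3`), `not_forall_betaLaw_noDriver`;
  (d) `IsProbabilityMeasure μ` is load-bearing in STUB B (`stub_betaPinning_false_without_probability`:
      zero measure, one-point space, zero driver, `a = 1/2`);
  (e) STUB C: constant kernels are crossing-martingale kernels of EVERY driver
      (`isCrossingMartingaleFamily_const`), so the affine freedom `A = 0` is necessary: the
      strengthening "∃ A ≠ 0, B, f = A·I_{2/3} + B" is false (`not_stub_kernelAffineBeta_nondegenerate`),
      and so is the LITERAL one "∃ a ∈ (0,1), ∃ A ≠ 0, B, f = A·I_a + B" (landed file 2: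
      `not_stub_kernelAffineBeta_nondegenerate_general`, via `betaLaw_strictMonoOn` — every `I_a`,
      `a < 1`, is strictly increasing on `[0,1)`, from the tree's `DyadicLattice.beta_pos` etc.).
  (f) STUB A (`stub_crossingMartingale`) and STUB D (`stub_kernelFacts`) have hypothesis
      `AllRectangleKernel f` = an instance of X_U: unconditionally irrefutable (any refutation proves
      X_U for some `f`).  In the Cardy world their conclusions are consistent: (a)–(b) give the model
      `(preWienerMeasure, √6 B, 𝓕ᵂ)` of STUB A's conclusion at `f = F` (orientation sign `s`, `∀ ω`
      continuity and `W 0 = 0` hold identically for `sleDriving`), and `F(0+) = 0`, `F(1-) = 1`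
      match STUB D (`tendsto_betaLaw_two_thirds_zero/one` of the defs module) — the arc convention of
      `HasCrossingLimit` (arcs 0 ↔ 2, `crossRatio → 0` for long rectangles) is the summit's.
* §5 MECHANISM CHECK (numbers, not Lean; `compute/farfield.py`, `compute/farfield2.py` in the seat
  folder, exact rational arithmetic).  Far-field expansion of `E f(η_t) = f(q)` for marks `λx`,
  `λ → ∞` (needs `E W_t = 0` from order `1/λ`, `E|W_t|³ < ∞` and the `L³` sup clause for the error
  terms, `f ∈ C²` near `q` with `f'(q) ≠ 0`):
      `E W_t² / t = -4 P / (Q + (f''/f')(q) R²)`,  `P = Σ ∂ᵢη/xᵢ`, `Q = Σᵢⱼ ∂ᵢ∂ⱼη`, `R = Σ ∂ᵢη`.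
  For `f = I_a` (`f''/f' = -a(1-2q)/(q(1-q))`): `= 6` for all 10 tested shapes iff `a = 2/3`; at
  `a = 1/2` it ranges over `[1208/201, 824/105] ≈ [6.01, 7.85]`, at `a = 3/4` over `≈ [5.37, 5.99]`
  — so NO regular driver has `I_a`-crossing martingales for `a ≠ 2/3` (STUB B true, by this route).
  Sharper: TWO shapes with the same modulus `q` already force `f''(q)/f'(q) = -(2/3)(1-2q)/(q(1-q))`
  AND `E W_t² = 6t` (tested at `q ∈ {1/10, 1/4, 1/2, 7/10}`, 8 shape pairs each, all exact): the far
  field pins `κ = 6` and `a = 2/3` SIMULTANEOUSLY, so STUB C's `∃ a ∈ (0,1)` is never sharper than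
  `a = 2/3` and STUBS B + C could be merged into "regular driver + crossing martingales for a
  non-constant `C²` kernel ⇒ `f = A·F + B`"; the research content of STUB C is only the bootstrap
  `ContinuousOn f (Ioo 0 1) ⇒ C²` (or a harmonic-measure argument avoiding it).
* §6 REMARKS FOR PROVERS.  (i) `ContinuousOn f (Ioo 0 1)` in STUB C is possibly unnecessary: for the
  zero driver the crossing-martingale property forces `f` constant on `(0,1)` with no continuity
  (trajectories `t ↦ η_t` are strictly increasing and sweep `[q, 1)`), and for `W = √6 B` optional
  stopping in the natural scale `s = F(η)` makes any bounded measurable crossing-martingale kernel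
  affine in `F` (informal).  (ii) Reading `f(cardyEta)` versus `f(1 - cardyEta)`: immaterial for `f = F`
  (`F(1-η) = 1 - F(η)`), and an all-rectangle kernel is symmetric by bond self-duality (informal).
  (iii) Dropping the `L³` clause of `IsRegularDriver` kills the far-field route of STUB B (no moment
  to expand) but no counterexample is known: truth open, not a target.

No kill.  Nothing in this file is `sorry`ed.
-/

noncomputable section

open MeasureTheory Filter Set Topology
open scoped NNReal ENNReal
open Literature.Probability.RandomPlanarGeometry
open Literature.Probability.Percolation (bondDomainCrossingProb)
open Literature.Probability.Process (exitTime preWienerMeasure brownian runSup runSup_nonneg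
  abs_brownian_le_runSup memLp_runSup_of_le_four)
open Summit.CriticalPhenomena.CardyFormulaZ2.Theses.DyadicBetaRigidity
  (CardyRigidity DyadicLatticeBetaLaw DyadicBetaSuffices)
open Summit.CriticalPhenomena.CardyFormulaZ2.Theses.CardyUniqueLimit (CardyUniqueLimitThesis)
open Summit.CriticalPhenomena.CardyFormulaZ2.Cruxes.CardyRigidity.CrossingMartingale

namespace Summit.CriticalPhenomena.CardyFormulaZ2.Cruxes.CardyRigidity.Disproof

/-! ## §1 Irrefutability: `¬ crux ↔ X_U ∧ ¬ CardyFormulaZ2` -/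

/-- The route decl of DyadicBetaRigidity and the registrar's crux decl (route CardyUniqueLimit) are
the same proposition. [folklore] -/
theorem crux_iff_cardyUniqueLimit :
    CardyRigidity ↔ Summit.CriticalPhenomena.CardyFormulaZ2.Theses.CardyUniqueLimit.CardyRigidity :=
  Iff.rfl

/-- **The conjunct implies the crux** (tree: `cardyRigidity_of_cardyFormulaZ2`, no SLE needed).
[folklore] -/
theorem crux_of_summit : _root_.CardyFormulaZ2 → CardyRigidity :=
  Cruxes.HalfPlaneMarkDensityLaw.SketchLine.cardyRigidity_of_cardyFormulaZ2

/-- **Exact logical position of the crux**: `CardyRigidity ↔ (X_U → CardyFormulaZ2)`. [folklore] -/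
theorem crux_iff_ucl_imp_summit : CardyRigidity ↔ (CardyUniqueLimitThesis → _root_.CardyFormulaZ2) := by
  constructor
  · rintro hC ⟨f, hf⟩ R φ x hφ
    have hη : crossRatio x ∈ Ioo (0 : ℝ) 1 :=
      ConformalRectangle.crossRatio_mem_Ioo_of_isUniformizing hφ
    show Tendsto _ _ _
    rw [← hC f hf hη]
    exact hf R φ x hφ
  · intro h f hf
    exact crux_of_summit (h ⟨f, hf⟩) f hf

/-- **`¬ crux ↔ X_U ∧ ¬ CardyFormulaZ2`**: a disproof of the crux is a proof of the open existence
statement X_U (stmt-0745) together with a disproof of Cardy's formula on `ℤ²`. [folklore] -/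
theorem not_crux_iff : ¬ CardyRigidity ↔ CardyUniqueLimitThesis ∧ ¬ _root_.CardyFormulaZ2 := by
  rw [crux_iff_ucl_imp_summit, Classical.not_imp]

/-- In the `¬ X_U` world the crux holds vacuously. [folklore] -/
theorem crux_of_not_ucl : ¬ CardyUniqueLimitThesis → CardyRigidity := fun h ↦
  crux_iff_ucl_imp_summit.2 fun hU ↦ (h hU).elim

/-! ## §2 Load-bearing analysis of the single hypothesis `AllRectangleKernel f` -/

/-- The crux with its hypothesis DROPPED: every real function is Cardy's on `(0,1)`. [folklore] -/
def CardyRigidityWithoutH : Prop :=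
  ∀ f : ℝ → ℝ, EqOn f cardyFunction (Ioo 0 1)

/-- **Any proof must use the hypothesis**: `CardyRigidityWithoutH` is false (`f = F + 1`).
[folklore] -/
theorem crux_false_without_H : ¬ CardyRigidityWithoutH := by
  intro h
  have := h (fun η ↦ cardyFunction η + 1) (show (1 / 2 : ℝ) ∈ Ioo 0 1 by norm_num)
  simp at this

/-- The crux with its hypothesis WEAKENED to a sub-family `𝓡` of conformal rectangles. [folklore] -/
def CardyRigidityOn (𝓡 : Set ConformalRectangle) : Prop :=
  ∀ f : ℝ → ℝ, (∀ R ∈ 𝓡, R.HasCrossingLimit (bondDomainCrossingProb R) f) →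
    EqOn f cardyFunction (Ioo 0 1)

/-- At `𝓡 = univ` the weakened statement is the crux. [folklore] -/
theorem cardyRigidityOn_univ_iff : CardyRigidityOn univ ↔ CardyRigidity :=
  ⟨fun h f hf ↦ h f fun R _ ↦ hf R, fun h f hf ↦ h f fun R ↦ hf R (mem_univ R)⟩

/-- `CardyRigidityOn` is antitone in the family (fewer rectangles = stronger statement). [folklore] -/
theorem cardyRigidityOn_antitone {𝓡 𝓡' : Set ConformalRectangle} (h𝓡 : 𝓡 ⊆ 𝓡') :
    CardyRigidityOn 𝓡 → CardyRigidityOn 𝓡' :=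
  fun h f hf ↦ h f fun R hR ↦ hf R (h𝓡 hR)

/-- At `𝓡 = ∅` the weakened statement is false (`f = F + 1`). [folklore] -/
theorem cardyRigidityOn_empty_false : ¬ CardyRigidityOn ∅ := by
  intro h
  have := h (fun η ↦ cardyFunction η + 1) (fun R hR ↦ hR.elim)
    (show (1 / 2 : ℝ) ∈ Ioo 0 1 by norm_num)
  simp at this

/-- **Why every finer weakening resists**: a refutation of `CardyRigidityOn 𝓡` exhibits a crossing
kernel for ALL of `𝓡` — for `𝓡 ≠ ∅` an existence-of-scaling-limit theorem for bond-`ℤ²` crossing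
probabilities (open in every instance). [folklore] -/
theorem exists_kernel_of_not_cardyRigidityOn {𝓡 : Set ConformalRectangle} (h : ¬ CardyRigidityOn 𝓡) :
    ∃ f : ℝ → ℝ, (∀ R ∈ 𝓡, R.HasCrossingLimit (bondDomainCrossingProb R) f) ∧
      ¬ EqOn f cardyFunction (Ioo 0 1) := by
  by_contra hne
  push Not at hne
  exact h fun f hf ↦ hne f hf

/-! ## §3 What route DyadicBetaRigidity actually consumes: pinning inside the beta family -/

/-- **Beta pinning** (percolation form): an all-rectangle kernel `I_a`, `a ∈ (0,1)`, has `a = 2/3`.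
This is `stub_crossingMartingale (f := I_a)` + `stub_betaPinning` of the line, and all the route
needs from the crux. [folklore] -/
def BetaPinning : Prop :=
  ∀ a ∈ Ioo (0 : ℝ) 1, AllRectangleKernel (betaLaw a) → a = 2 / 3

/-- `I_{2/3} = F` on `[0,1]`. [cite: Cardy1992, eq. (8)] -/
theorem betaLaw_two_thirds_eq_cardyFunction {η : ℝ} (hη : η ∈ Icc (0 : ℝ) 1) :
    betaLaw (2 / 3) η = cardyFunction η := by
  rw [betaLaw_two_thirds, cardyFunction_eq_incBeta13_div_holds η hη]

/-- The crux implies beta pinning, GIVEN that distinct `I_a` differ on `(0,1)` from `F` — we only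
need the converse direction for the route, recorded next; this direction is stated for `a = 2/3`'s
uniqueness among kernels equal to `F`: if `I_a = F` on `(0,1)` forces `a = 2/3` (`hinj`), the crux
gives `BetaPinning`. [folklore] -/
theorem betaPinning_of_crux
    (hinj : ∀ a ∈ Ioo (0 : ℝ) 1, EqOn (betaLaw a) cardyFunction (Ioo 0 1) → a = 2 / 3)
    (hC : CardyRigidity) : BetaPinning :=
  fun a ha hK ↦ hinj a ha (hC _ hK)

/-- **The deciding theorem re-glued on `BetaPinning`**:
`DyadicLatticeBetaLaw → BetaPinning → DyadicBetaSuffices → CardyFormulaZ2` (same proof as `closes`,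
with `I_{2/3} = F`). [folklore] -/
theorem closes_of_betaPinning (h₁ : DyadicLatticeBetaLaw) (h₂ : BetaPinning)
    (h₃ : DyadicBetaSuffices) : _root_.CardyFormulaZ2 := by
  obtain ⟨a, ha, hD⟩ := h₁
  have hall := h₃ a ha hD
  have ha23 : a = 2 / 3 := h₂ a ha hall
  subst ha23
  intro R φ x hφ
  have hη : crossRatio x ∈ Ioo (0 : ℝ) 1 :=
    ConformalRectangle.crossRatio_mem_Ioo_of_isUniformizing hφ
  show Tendsto _ _ _
  rw [← betaLaw_two_thirds_eq_cardyFunction (Ioo_subset_Icc_self hη)]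
  exact hall R φ x hφ

/-! ## §4 Line `crossing_martingale`: models, tightness, load-bearing hypotheses of the stubs

(Reproduced from the LANDED Negative lemma file `Theorems/CardyRigidity/Negative/CrossingMartingaleTight.lean`
(p145347) so that this work file stands alone; `betaLaw_strictMonoOn` and the literal `A ≠ 0`
refutation are in `…/Negative/CrossingMartingaleBetaLaw.lean` (p145401).  All objects are the line's
own, from its landed definitions module.) -/

/-- `I_{2/3}` is not constant on `(0,1)`. [folklore] -/
theorem exists_betaLaw_two_thirds_ne :
    ∃ η₁ ∈ Ioo (0 : ℝ) 1, ∃ η₂ ∈ Ioo (0 : ℝ) 1, betaLaw (2 / 3) η₁ ≠ betaLaw (2 / 3) η₂ := by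
  have h₁ : ∀ᶠ η in 𝓝[>] (0 : ℝ), betaLaw (2 / 3) η < 1 / 2 ∧ η ∈ Ioo (0 : ℝ) 1 :=
    (tendsto_betaLaw_two_thirds_zero.eventually (Iio_mem_nhds (by norm_num))).and
      (Ioo_mem_nhdsGT zero_lt_one)
  have h₂ : ∀ᶠ η in 𝓝[<] (1 : ℝ), 1 / 2 < betaLaw (2 / 3) η ∧ η ∈ Ioo (0 : ℝ) 1 :=
    (tendsto_betaLaw_two_thirds_one.eventually (Ioi_mem_nhds (by norm_num))).and
      (Ioo_mem_nhdsLT zero_lt_one)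
  obtain ⟨η₁, hη₁, hη₁'⟩ := h₁.exists
  obtain ⟨η₂, hη₂, hη₂'⟩ := h₂.exists
  exact ⟨η₁, hη₁', η₂, hη₂', fun h ↦ by linarith⟩

/-- **(a) `√κ B` is a regular driver** on `(ℝ≥0 → ℝ, preWienerMeasure)` for the Brownian filtration.
[cite: KemppainenSmirnov2017, Thm 1.3] -/
theorem isRegularDriver_sleDriving (κ : ℝ≥0) :
    IsRegularDriver preWienerMeasure (fun ω ↦ sleDriving κ ω) brownianFiltration := by
  refine ⟨fun t ↦ ?_, continuous_sleDriving κ, sleDriving_zero κ, fun t ↦ ?_⟩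
  · exact (stronglyAdapted_brownian t).const_mul (Real.sqrt κ)
  · refine ⟨fun ω ↦ Real.sqrt κ * runSup t ω, ?_, fun ω ↦ ?_, ae_of_all _ fun ω u hu ↦ ?_⟩
    · exact (memLp_runSup_of_le_four t (by norm_num)).const_mul _
    · exact mul_nonneg (Real.sqrt_nonneg _) (runSup_nonneg t ω)
    · show |sleDriving κ ω u| ≤ Real.sqrt κ * runSup t ω
      rw [sleDriving_apply, abs_mul, abs_of_nonneg (Real.sqrt_nonneg _)]
      exact mul_le_mul_of_nonneg_left (abs_brownian_le_runSup hu ω) (Real.sqrt_nonneg _)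

/-- The zero path is a regular driver (any finite measure, any filtration). [folklore] -/
theorem isRegularDriver_zero {Ω : Type*} [MeasurableSpace Ω] (μ : Measure Ω) [IsFiniteMeasure μ]
    (𝓕 : Filtration ℝ≥0 ‹MeasurableSpace Ω›) : IsRegularDriver μ (fun _ _ ↦ 0) 𝓕 :=
  ⟨fun _ ↦ stronglyMeasurable_const, fun _ ↦ continuous_const, fun _ ↦ rfl,
    fun _ ↦ ⟨fun _ ↦ 0, memLp_const 0, fun _ ↦ le_rfl, ae_of_all _ fun _ _ _ ↦ by simp⟩⟩

/-- **(b) For `√κ B` the line's level stopping time IS `cardyLevelTime`** (definitionally).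
[folklore] -/
theorem levelTime_sleDriving (κ : ℝ≥0) (x : Fin 3 → ℝ) (m M d : ℝ) :
    levelTime (fun ω ↦ sleDriving κ ω) x m M d = cardyLevelTime κ x m M d := rfl

/-- For `W = √6 B` and admissible data the line's `I_{2/3}`-observable is `cardyObsStopped 6`.
[cite: WernerPCMI2009, §3] -/
theorem crossingObs_sleDriving_six_eq {x : Fin 3 → ℝ} {m M d : ℝ} (h : AdmissibleLevels x m M d) :
    crossingObs (betaLaw (2 / 3)) (fun ω ↦ sleDriving 6 ω) x m M d = cardyObsStopped 6 x m M d := by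
  funext t ω
  have hη := cardyEta_stopped_mem_Ioo (κ := 6) h.strictMono h.pos h.m_pos h.m_lt h.lt_M h.d_pos
    h.d_lt₁ h.d_lt₂ t ω
  show betaLaw (2 / 3) (cardyEta _ _ _) = cardyFunction (cardyEta _ _ _)
  exact betaLaw_two_thirds_eq_cardyFunction (Ioo_subset_Icc_self hη)

/-- **The SLE₆ driver has the crossing-martingale property for `I_{2/3}`**
(`martingale_cardyObsStopped_six`). [cite: WernerPCMI2009, §3] -/
theorem isCrossingMartingaleFamily_betaLaw_two_thirds_six :
    IsCrossingMartingaleFamily (betaLaw (2 / 3)) preWienerMeasure (fun ω ↦ sleDriving 6 ω)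
      brownianFiltration := by
  intro x m M d h
  rw [crossingObs_sleDriving_six_eq h]
  exact martingale_cardyObsStopped_six h.strictMono h.pos h.m_pos h.m_lt h.lt_M h.d_pos
    h.d_lt₁ h.d_lt₂

/-- **(e) Constant kernels are crossing-martingale kernels of every driver.** [folklore] -/
theorem isCrossingMartingaleFamily_const {Ω : Type*} [MeasurableSpace Ω] (μ : Measure Ω)
    [IsFiniteMeasure μ] (c : ℝ) (W : Ω → ℝ≥0 → ℝ) (𝓕 : Filtration ℝ≥0 ‹MeasurableSpace Ω›) :
    IsCrossingMartingaleFamily (fun _ ↦ c) μ W 𝓕 :=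
  fun _ _ _ _ _ ↦ martingale_const 𝓕 μ c

/-- **(c) STUB B is tight**: its hypothesis is satisfied at `a = 2/3`. [cite: WernerPCMI2009, §3] -/
theorem stub_betaPinning_tight :
    ∃ (Ω : Type) (_ : MeasurableSpace Ω) (μ : Measure Ω) (_ : IsProbabilityMeasure μ)
      (W : Ω → ℝ≥0 → ℝ) (𝓕 : Filtration ℝ≥0 ‹MeasurableSpace Ω›),
      IsRegularDriver μ W 𝓕 ∧ IsCrossingMartingaleFamily (betaLaw (2 / 3)) μ W 𝓕 :=
  ⟨ℝ≥0 → ℝ, inferInstance, preWienerMeasure, isProbabilityMeasure_preWienerMeasure',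
    fun ω ↦ sleDriving 6 ω, brownianFiltration, isRegularDriver_sleDriving 6,
    isCrossingMartingaleFamily_betaLaw_two_thirds_six⟩

/-- **The conclusion of STUB B is forced to be `2/3`.** [folklore] -/
theorem stub_betaPinning_conclusion_forced {c : ℝ}
    (h : ∀ a ∈ Ioo (0 : ℝ) 1, ∀ (Ω : Type) [MeasurableSpace Ω] (μ : Measure Ω)
      [IsProbabilityMeasure μ] (W : Ω → ℝ≥0 → ℝ) (𝓕 : Filtration ℝ≥0 ‹MeasurableSpace Ω›),
      IsRegularDriver μ W 𝓕 → IsCrossingMartingaleFamily (betaLaw a) μ W 𝓕 → a = c) :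
    c = 2 / 3 := by
  haveI := isProbabilityMeasure_preWienerMeasure'
  exact (h (2 / 3) ⟨by norm_num, by norm_num⟩ (ℝ≥0 → ℝ) preWienerMeasure (fun ω ↦ sleDriving 6 ω)
    brownianFiltration (isRegularDriver_sleDriving 6)
    isCrossingMartingaleFamily_betaLaw_two_thirds_six).symm

/-- **Refuted strengthening of STUB B**: "no `a ∈ (0,1)` admits a regular `I_a`-crossing-martingale
driver" is false. [folklore] -/
theorem not_forall_betaLaw_noDriver :
    ¬ (∀ a ∈ Ioo (0 : ℝ) 1, ∀ (Ω : Type) [MeasurableSpace Ω] (μ : Measure Ω)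
        [IsProbabilityMeasure μ] (W : Ω → ℝ≥0 → ℝ) (𝓕 : Filtration ℝ≥0 ‹MeasurableSpace Ω›),
        IsRegularDriver μ W 𝓕 → ¬ IsCrossingMartingaleFamily (betaLaw a) μ W 𝓕) := by
  intro h
  haveI := isProbabilityMeasure_preWienerMeasure'
  exact h (2 / 3) ⟨by norm_num, by norm_num⟩ (ℝ≥0 → ℝ) preWienerMeasure (fun ω ↦ sleDriving 6 ω)
    brownianFiltration (isRegularDriver_sleDriving 6)
    isCrossingMartingaleFamily_betaLaw_two_thirds_six

/-- **(d) `IsProbabilityMeasure μ` is load-bearing in STUB B.** [folklore] -/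
theorem stub_betaPinning_false_without_probability :
    ¬ (∀ a ∈ Ioo (0 : ℝ) 1, ∀ (Ω : Type) [MeasurableSpace Ω] (μ : Measure Ω)
        (W : Ω → ℝ≥0 → ℝ) (𝓕 : Filtration ℝ≥0 ‹MeasurableSpace Ω›),
        IsRegularDriver μ W 𝓕 → IsCrossingMartingaleFamily (betaLaw a) μ W 𝓕 → a = 2 / 3) := by
  intro h
  have key : IsCrossingMartingaleFamily (betaLaw (1 / 2)) (0 : Measure Unit) (fun _ _ ↦ 0) ⊥ := by
    intro x m M d _
    refine ⟨fun t ↦ ?_, fun i j _ ↦ ?_⟩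
    · have : crossingObs (betaLaw (1 / 2)) (fun (_ : Unit) (_ : ℝ≥0) ↦ (0 : ℝ)) x m M d t =
          fun _ ↦ crossingObs (betaLaw (1 / 2)) (fun (_ : Unit) (_ : ℝ≥0) ↦ (0 : ℝ)) x m M d t () := by
        funext u; rfl
      rw [this]
      exact stronglyMeasurable_const
    · rw [Filter.EventuallyEq, ae_zero]
      exact Filter.eventually_bot
  have := h (1 / 2) ⟨by norm_num, by norm_num⟩ Unit (0 : Measure Unit) (fun _ _ ↦ 0) ⊥
    (isRegularDriver_zero _ _) key
  norm_num at this

/-- **(e) Refuted strengthening of STUB C**: a crossing-martingale kernel need not be a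
NON-DEGENERATE affine Cardy law (`f ≡ 0` with the SLE₆ driver). [folklore] -/
theorem not_stub_kernelAffineBeta_nondegenerate :
    ¬ (∀ f : ℝ → ℝ, ContinuousOn f (Ioo 0 1) →
        ∀ (Ω : Type) [MeasurableSpace Ω] (μ : Measure Ω) [IsProbabilityMeasure μ]
          (W : Ω → ℝ≥0 → ℝ) (𝓕 : Filtration ℝ≥0 ‹MeasurableSpace Ω›),
          IsRegularDriver μ W 𝓕 → IsCrossingMartingaleFamily f μ W 𝓕 →
            ∃ A B : ℝ, A ≠ 0 ∧ EqOn f (fun η ↦ A * betaLaw (2 / 3) η + B) (Ioo 0 1)) := by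
  intro h
  haveI := isProbabilityMeasure_preWienerMeasure'
  obtain ⟨A, B, hA, hAB⟩ := h (fun _ ↦ 0) continuousOn_const (ℝ≥0 → ℝ) preWienerMeasure
    (fun ω ↦ sleDriving 6 ω) brownianFiltration (isRegularDriver_sleDriving 6)
    (isCrossingMartingaleFamily_const _ _ _ _)
  obtain ⟨η₁, h₁, η₂, h₂, hne⟩ := exists_betaLaw_two_thirds_ne
  have e₁ := hAB h₁
  have e₂ := hAB h₂
  simp only at e₁ e₂
  exact hne (mul_left_cancel₀ hA (by linarith))

-- Targets: none yet (the lead's STUCK list is empty at this cycle; the lead holds `stub_betaPinning`).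

end Summit.CriticalPhenomena.CardyFormulaZ2.Cruxes.CardyRigidity.Disproof

end
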